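import Summits.ResolutionOfSingularities.ResolutionOfSingularities.Theorems.RadicialJungCleanModelsStubCossartPiltant2019Leaves
import Literature.AlgebraicGeometry.Resolution.ArithmeticalThreefoldsDescentHeadRankOne
import Literature.AlgebraicGeometry.Resolution.ArithmeticalThreefoldsDescentHeadChoice
import HarnessLib

/-!
# `CleanModels`, stub 2 (`stub_cossartPiltant2019` = F-02): the descent leaf RE-CUT AT RANK ONE, in kernel

OURS (decomp-res hand-1 g17; crux `stmt-ResolutionOfSingularities-15917`, skeleton rev 35 `Cruxes/CleanModels/Lines/Sketch.lean`,
stub `stub_cossartPiltant2019 : CossartPiltant2019.{0}`). A BOOKKEEPING file continuing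
`RadicialJungCleanModelsStubCossartPiltant2019Leaves.lean` (hand-1 g16: F-02 ⟸ { `CossartPiltant2019Local`,
`CossartJannsenSaito2020Embedded` (= stub 1), `hEqT`, `hEqI`, `Hironaka1964_local`, `CossartPiltant2019_descentHead` }).

FINDING of this generation: the last non-printed, non-research leaf `CossartPiltant2019_descentHead` (the geometric head of
Cossart–Piltant 2019 Prop. 4.8: Thm. 1.1 for `Spec Â` + Lemma 4.7 + density) is consumed by the tree's
`CossartPiltant2019LU3OfComplete.of_head` along valuations of EVERY rank, whereas the printed proof FIRST reduces to rank one
("we may assume that `dim 𝒪_v = 1` … applying [NSp] theorem 1.1", arXiv v1 p. 53) and its Lemma 4.7 is [CoP1] Prop. 8.1, a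
rank-one monomialization.  The tree PROVES Novacoski–Spivakovsky's Thm. 1.1 (`NovacoskiSpivakovsky2014_holds`), but in a form that
needs rank-one local uniformization in ALL dimensions; hand-1 g17 cut it to bounded transcendence degree
(`relLocalUniformization_of_rankOne_of_trdeg_le`), re-did the closed-points reduction at rank one
(`localUniformization3_of_closedPoints_rankOne`) and the pointwise head (`exists_adjoin_isRegularLocalRing_of_headAt`), and
assembled `CossartPiltant2019LU3OfComplete.of_headRankOne`.  This file threads that through the leaf list:

* `cossartPiltant2019_of_reductionP_headRankOne` — `CossartPiltant2019Local → CossartPiltant2019ReductionP → Hironaka1964_local →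
  (descent head ALONG RANK-ONE VALUATIONS) → CossartJannsenSaito2020 → CossartPiltant2019` (patching discharged);
* `cossartPiltant2019_of_stub1_of_leaves_headRankOne` — **F-02 at universe `0` ⟸ { `CossartPiltant2019Local` (CP Thm. 1.5),
  `CossartJannsenSaito2020Embedded.{0}` (= the TYPE of stub 1), `hEqT`, `hEqI` (research), `Hironaka1964_local` (idle at
  characteristic `p`), the descent head ALONG RANK-ONE VALUATIONS }** — the head binder of `CossartPiltant2019LU3OfComplete.of_head`
  with the extra premise `Nonempty O.valuation.RankOne`, i.e. exactly the printed situation of Lemma 4.7 / [CoP1] Prop. 8.1;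
* `cossartPiltant2019_of_stub1_of_leaves_headChoiceRankOne` (append) — the same with the head in `∃`-form (the prover CHOOSES the
  formal branch `K̂₁` and the extension `v̂`, as in print), via `CossartPiltant2019LU3OfComplete.of_headChoiceRankOne`.

Nothing here proves resolution of singularities in positive characteristic, local uniformization, or any statement of a manuscript
under adjudication. AI-written; AI review weaker than expert review.
-/

-- `Summit.<Summit>.<Sub>.Theorems` with `Sub = Summit` (single-conjunct summit, D-0017)
set_option linter.dupNamespace false

noncomputable section

open IsLocalRing Polynomial
open Literature.AlgebraicGeometry.Resolution
open Summit.ResolutionOfSingularities.ResolutionOfSingularities.Theorems.CP2008Prop44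

namespace Summit.ResolutionOfSingularities.ResolutionOfSingularities.Theorems.RadicialJung.CleanModels

/-- **F-02 from the local theorem, the reduction `CossartPiltant2019ReductionP`, Hironaka's theorem over local quasi-excellent rings
of residue characteristic zero, the geometric head of CP 2019 Prop. 4.8 ALONG RANK-ONE VALUATIONS, and Cossart–Jannsen–Saito Thm. 1.2
over fields** — the tree's assembly `cossartPiltant2019_of_local` with its residue-characteristic-zero leaf fed by
`CossartPiltant2019LUCompleteChar0_holds_of`, its Prop. 4.8 leaf by `CossartPiltant2019LU3OfComplete.of_headRankOne` (hand-1 g17: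
Novacoski–Spivakovsky in transcendence degree `≤ 3` + closed points at rank one + the pointwise head), and the patching leaf
DISCHARGED by `CossartPiltant2019Patching_holds`.  Universe `0`.
[cite: CossartPiltant2019, Thm. 1.1, Ch. 4 (Props. 4.6, 4.8 with Lemma 4.7, 4.10)] [cite: NovacoskiSpivakovsky2014, Thm. 1.1] -/
theorem cossartPiltant2019_of_reductionP_headRankOne (hloc : CossartPiltant2019Local.{0})
    (hred : CossartPiltant2019ReductionP.{0}) (hH : Hironaka1964_local.{0})
    (hhead : CossartPiltant2019LUComplete3.{0} →
      ∀ (k B : Type) [Field k] [CommRing B] [IsDomain B] [Algebra k B] [Algebra.FiniteType k B]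
        (p : Ideal B) [p.IsMaximal], ringKrullDim B = 3 →
        ringKrullDim (Localization.AtPrime p) = 3 →
      ∀ (K : Type) [Field K] [Algebra (Localization.AtPrime p) K]
        [IsFractionRing (Localization.AtPrime p) K] (O : ValuationSubring K),
      Nonempty O.valuation.RankOne →
      (∀ x : Localization.AtPrime p, algebraMap _ K x ∈ O) →
      (∀ x ∈ maximalIdeal (Localization.AtPrime p), O.valuation (algebraMap _ K x) < 1) →
      (∀ y : O, ∃ q : Polynomial (Localization.AtPrime p),
        (∃ i, q.coeff i ∉ maximalIdeal (Localization.AtPrime p)) ∧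
        O.valuation (q.eval₂ (algebraMap _ K) y) < 1) →
      ∀ (K₁ : Type) [Field K₁]
        [Algebra (AdicCompletion (maximalIdeal (Localization.AtPrime p))
          (Localization.AtPrime p)) K₁],
      RingHom.ker (algebraMap (AdicCompletion (maximalIdeal (Localization.AtPrime p))
          (Localization.AtPrime p)) K₁) ∈
        minimalPrimes (AdicCompletion (maximalIdeal (Localization.AtPrime p))
          (Localization.AtPrime p)) →
      (∀ z : K₁, ∃ a b : AdicCompletion (maximalIdeal (Localization.AtPrime p))
          (Localization.AtPrime p), z = algebraMap _ K₁ a / algebraMap _ K₁ b) →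
      ∀ (ι : K →+* K₁), ι.comp (algebraMap (Localization.AtPrime p) K) =
        (algebraMap (AdicCompletion (maximalIdeal (Localization.AtPrime p))
          (Localization.AtPrime p)) K₁).comp (algebraMap (Localization.AtPrime p) _) →
      ∀ (O' : ValuationSubring K₁),
      (∀ x : AdicCompletion (maximalIdeal (Localization.AtPrime p)) (Localization.AtPrime p),
        algebraMap _ K₁ x ∈ O') →
      (∀ x ∈ (maximalIdeal (Localization.AtPrime p)).map (algebraMap (Localization.AtPrime p)
          (AdicCompletion (maximalIdeal (Localization.AtPrime p)) (Localization.AtPrime p))),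
        O'.valuation (algebraMap _ K₁ x) < 1) →
      (∀ y : O', ∃ q : Polynomial (AdicCompletion (maximalIdeal (Localization.AtPrime p))
          (Localization.AtPrime p)),
        (∃ i, q.coeff i ∉ (maximalIdeal (Localization.AtPrime p)).map
          (algebraMap (Localization.AtPrime p)
            (AdicCompletion (maximalIdeal (Localization.AtPrime p)) (Localization.AtPrime p)))) ∧
        O'.valuation (q.eval₂ (algebraMap _ K₁) y) < 1) →
      O'.comap ι = O →
      ∃ (S : Type) (_ : CommRing S) (_ : IsRegularLocalRing S)
        (_ : Algebra (AdicCompletion (maximalIdeal (Localization.AtPrime p))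
          (Localization.AtPrime p)) S) (_ : Algebra S K₁),
        IsLocalHom (algebraMap (AdicCompletion (maximalIdeal (Localization.AtPrime p))
          (Localization.AtPrime p)) S) ∧
        Algebra.EssFiniteType (AdicCompletion (maximalIdeal (Localization.AtPrime p))
          (Localization.AtPrime p)) S ∧
        IsScalarTower (AdicCompletion (maximalIdeal (Localization.AtPrime p))
          (Localization.AtPrime p)) S K₁ ∧
        Function.Injective (algebraMap S K₁) ∧
        (∀ s : S, algebraMap S K₁ s ∈ O') ∧
        (∀ s ∈ maximalIdeal S, O'.valuation (algebraMap S K₁ s) < 1) ∧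
        ∃ (d : ℕ) (z : Fin d → S) (a : Fin d → ℕ) (c : Fin d → Sˣ) (g : Fin d → K),
          Ideal.span (Set.range z) = maximalIdeal S ∧ (∀ j, 0 < a j) ∧
          ∀ j, ι (g j) = algebraMap S K₁ (c j * z j ^ a j))
    (hCJS : CossartJannsenSaito2020.{0}) : CossartPiltant2019.{0} :=
  cossartPiltant2019_of_local hloc hred (CossartPiltant2019LUCompleteChar0_holds_of hH)
    (CossartPiltant2019LU3OfComplete.of_headRankOne hCJS hhead) hCJS CossartPiltant2019Patching_holds

/-- **STUB 2 FROM STUB 1 + THE NAMED RESIDUE, DESCENT HEAD AT RANK ONE (universe `0`)** (hand-1 g17): `CossartPiltant2019.{0}` (the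
type of `stub_cossartPiltant2019`) from `CossartPiltant2019Local` (CP Thm. 1.5), `CossartJannsenSaito2020Embedded.{0}` (the TYPE of
stub 1 `stub_cjs2020Thm14`), `hEqT`, `hEqI` (not in print; VERBATIM the hypotheses of
`cossartPiltant2019ReductionP_of_embPrinted_of_equivariantLU_split`), `Hironaka1964_local` (Temkin 2008; idle at characteristic `p`)
and the geometric head of CP 2019 Prop. 4.8 ALONG RANK-ONE VALUATIONS ONLY (the binder `head` of
`CossartPiltant2019LU3OfComplete.of_head` with the extra premise `Nonempty O.valuation.RankOne` — the printed situation of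
Lemma 4.7 = [CoP1] Prop. 8.1); principalization, patching, CJS Thm. 1.2 over fields (`cossartJannsenSaito2020_of_embedded`), the
rank-one reduction of Prop. 4.10 (C5) AND NOW the rank-one reduction of Prop. 4.8 (Novacoski–Spivakovsky in transcendence degree
`≤ 3`) are DISCHARGED in the tree.
[cite: CossartPiltant2019, Thm. 1.1, Thm. 1.5, Props. 4.4, 4.6, 4.8 with Lemma 4.7, 4.10] [cite: CossartPiltant2008, Prop. 8.1, Prop. 9.3, Lemma 9.4]
[cite: CossartJannsenSaito2020, Thm. 1.2, Thm. 1.4] [cite: NovacoskiSpivakovsky2014, Thm. 1.1] -/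
theorem cossartPiltant2019_of_stub1_of_leaves_headRankOne
    (hloc : CossartPiltant2019Local.{0}) (hCJSE : CossartJannsenSaito2020Embedded.{0})
    (hEqT :
      ∀ (p : ℕ), p.Prime →
      ∀ (S : Type) [CommRing S] [IsDomain S] [IsRegularLocalRing S],
        IsExcellentRing S → ringKrullDim S = 3 → CharP (ResidueField S) p →
        IsAdicComplete (maximalIdeal S) S →
      ∀ (E : Type) [Field E] [Algebra S E], Function.Injective (algebraMap S E) →
        IsAlgClosed E → Algebra.IsAlgebraic S E →
      ∀ (OE : ValuationSubring E), (∀ s : S, algebraMap S E s ∈ OE) →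
        (∀ s ∈ maximalIdeal S, OE.valuation (algebraMap S E s) < 1) →
        (∀ y : OE, ∃ q : S[X], (∃ i, q.coeff i ∉ maximalIdeal S) ∧
          OE.valuation (q.eval₂ (algebraMap S E) y) < 1) →
      Nonempty OE.valuation.RankOne →
      ∀ (M' : Subfield E), (∀ s : S, algebraMap S E s ∈ M') →
      ∀ (H : Subgroup (E ≃ₐ[S] E)),
        (∀ σ ∈ H, ∀ x ∈ M', σ x ∈ M') →
        (∀ σ ∈ H, ∀ x ∈ M', x ∈ OE → σ x ∈ OE) →
        (∀ σ ∈ H, ∀ x ∈ M', x ∈ OE → OE.valuation (σ x - x) < 1) →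
        (∃ ℓ : ℕ, ℓ.Prime ∧ ℓ ≠ p ∧ ∀ σ ∈ H, ∀ x ∈ M', (σ ^ ℓ) x = x) →
        (∀ σ ∈ H, (∃ x ∈ M', σ x ≠ x) →
          ∃ x ∈ M', x ≠ 0 ∧ OE.valuation (σ x - x) = OE.valuation x) →
        (∃ t : Finset E, (t : Set E) ⊆ M' ∧
          M' ≤ Subfield.closure (Set.range (algebraMap S E) ∪ (t : Set E)) ∧
          ∃ hTO : (Algebra.adjoin S (t : Set E)).toSubring ≤ OE.toSubring,
            IsRegularLocalRing (Localization.AtPrime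
              (Ideal.comap (Subring.inclusion hTO) (maximalIdeal OE)))) →
        ∃ t : Finset E, (t : Set E) ⊆ M' ∧
          M' ≤ Subfield.closure (Set.range (algebraMap S E) ∪ (t : Set E)) ∧
          ∃ hTO : (Algebra.adjoin S (t : Set E)).toSubring ≤ OE.toSubring,
            IsRegularLocalRing (Localization.AtPrime
              (Ideal.comap (Subring.inclusion hTO) (maximalIdeal OE))) ∧
            (∀ σ ∈ H, ∀ x ∈ locAtCentre (Algebra.adjoin S (t : Set E)).toSubring OE,
              σ x ∈ locAtCentre (Algebra.adjoin S (t : Set E)).toSubring OE))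
    (hEqI :
      ∀ (p : ℕ), p.Prime →
      ∀ (S : Type) [CommRing S] [IsDomain S] [IsRegularLocalRing S],
        IsExcellentRing S → ringKrullDim S = 3 → CharP (ResidueField S) p →
        IsAdicComplete (maximalIdeal S) S →
      ∀ (E : Type) [Field E] [Algebra S E], Function.Injective (algebraMap S E) →
        IsAlgClosed E → Algebra.IsAlgebraic S E →
      ∀ (OE : ValuationSubring E), (∀ s : S, algebraMap S E s ∈ OE) →
        (∀ s ∈ maximalIdeal S, OE.valuation (algebraMap S E s) < 1) →
        (∀ y : OE, ∃ q : S[X], (∃ i, q.coeff i ∉ maximalIdeal S) ∧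
          OE.valuation (q.eval₂ (algebraMap S E) y) < 1) →
      Nonempty OE.valuation.RankOne →
      ∀ (M' : Subfield E), (∀ s : S, algebraMap S E s ∈ M') →
      ∀ (H : Subgroup (E ≃ₐ[S] E)),
        (∀ σ ∈ H, ∀ x ∈ M', σ x ∈ M') →
        (∀ σ ∈ H, ∀ x ∈ M', x ∈ OE → σ x ∈ OE) →
        (∀ σ ∈ H, (∃ x ∈ M', σ x ≠ x) →
          ∃ x ∈ M', OE.valuation x = 1 ∧ OE.valuation (σ x - x) = 1) →
      ∀ (x₀ : E), x₀ ∈ M' → x₀ ∈ OE →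
        (∃ t : Finset E, (t : Set E) ⊆ M' ∧
          M' ≤ Subfield.closure (Set.range (algebraMap S E) ∪ (t : Set E)) ∧
          ∃ hTO : (Algebra.adjoin S (t : Set E)).toSubring ≤ OE.toSubring,
            IsRegularLocalRing (Localization.AtPrime
              (Ideal.comap (Subring.inclusion hTO) (maximalIdeal OE)))) →
        ∃ t : Finset E, (t : Set E) ⊆ M' ∧
          M' ≤ Subfield.closure (Set.range (algebraMap S E) ∪ (t : Set E)) ∧
          ∃ hTO : (Algebra.adjoin S (t : Set E)).toSubring ≤ OE.toSubring,
            IsRegularLocalRing (Localization.AtPrime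
              (Ideal.comap (Subring.inclusion hTO) (maximalIdeal OE))) ∧
            (∀ σ ∈ H, ∀ x ∈ locAtCentre (Algebra.adjoin S (t : Set E)).toSubring OE,
              σ x ∈ locAtCentre (Algebra.adjoin S (t : Set E)).toSubring OE) ∧
            x₀ ∈ locAtCentre (Algebra.adjoin S (t : Set E)).toSubring OE)
    (hH : Hironaka1964_local.{0})
    (hhead : CossartPiltant2019LUComplete3.{0} →
      ∀ (k B : Type) [Field k] [CommRing B] [IsDomain B] [Algebra k B] [Algebra.FiniteType k B]
        (p : Ideal B) [p.IsMaximal], ringKrullDim B = 3 →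
        ringKrullDim (Localization.AtPrime p) = 3 →
      ∀ (K : Type) [Field K] [Algebra (Localization.AtPrime p) K]
        [IsFractionRing (Localization.AtPrime p) K] (O : ValuationSubring K),
      Nonempty O.valuation.RankOne →
      (∀ x : Localization.AtPrime p, algebraMap _ K x ∈ O) →
      (∀ x ∈ maximalIdeal (Localization.AtPrime p), O.valuation (algebraMap _ K x) < 1) →
      (∀ y : O, ∃ q : Polynomial (Localization.AtPrime p),
        (∃ i, q.coeff i ∉ maximalIdeal (Localization.AtPrime p)) ∧
        O.valuation (q.eval₂ (algebraMap _ K) y) < 1) →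
      ∀ (K₁ : Type) [Field K₁]
        [Algebra (AdicCompletion (maximalIdeal (Localization.AtPrime p))
          (Localization.AtPrime p)) K₁],
      RingHom.ker (algebraMap (AdicCompletion (maximalIdeal (Localization.AtPrime p))
          (Localization.AtPrime p)) K₁) ∈
        minimalPrimes (AdicCompletion (maximalIdeal (Localization.AtPrime p))
          (Localization.AtPrime p)) →
      (∀ z : K₁, ∃ a b : AdicCompletion (maximalIdeal (Localization.AtPrime p))
          (Localization.AtPrime p), z = algebraMap _ K₁ a / algebraMap _ K₁ b) →
      ∀ (ι : K →+* K₁), ι.comp (algebraMap (Localization.AtPrime p) K) =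
        (algebraMap (AdicCompletion (maximalIdeal (Localization.AtPrime p))
          (Localization.AtPrime p)) K₁).comp (algebraMap (Localization.AtPrime p) _) →
      ∀ (O' : ValuationSubring K₁),
      (∀ x : AdicCompletion (maximalIdeal (Localization.AtPrime p)) (Localization.AtPrime p),
        algebraMap _ K₁ x ∈ O') →
      (∀ x ∈ (maximalIdeal (Localization.AtPrime p)).map (algebraMap (Localization.AtPrime p)
          (AdicCompletion (maximalIdeal (Localization.AtPrime p)) (Localization.AtPrime p))),
        O'.valuation (algebraMap _ K₁ x) < 1) →
      (∀ y : O', ∃ q : Polynomial (AdicCompletion (maximalIdeal (Localization.AtPrime p))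
          (Localization.AtPrime p)),
        (∃ i, q.coeff i ∉ (maximalIdeal (Localization.AtPrime p)).map
          (algebraMap (Localization.AtPrime p)
            (AdicCompletion (maximalIdeal (Localization.AtPrime p)) (Localization.AtPrime p)))) ∧
        O'.valuation (q.eval₂ (algebraMap _ K₁) y) < 1) →
      O'.comap ι = O →
      ∃ (S : Type) (_ : CommRing S) (_ : IsRegularLocalRing S)
        (_ : Algebra (AdicCompletion (maximalIdeal (Localization.AtPrime p))
          (Localization.AtPrime p)) S) (_ : Algebra S K₁),
        IsLocalHom (algebraMap (AdicCompletion (maximalIdeal (Localization.AtPrime p))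
          (Localization.AtPrime p)) S) ∧
        Algebra.EssFiniteType (AdicCompletion (maximalIdeal (Localization.AtPrime p))
          (Localization.AtPrime p)) S ∧
        IsScalarTower (AdicCompletion (maximalIdeal (Localization.AtPrime p))
          (Localization.AtPrime p)) S K₁ ∧
        Function.Injective (algebraMap S K₁) ∧
        (∀ s : S, algebraMap S K₁ s ∈ O') ∧
        (∀ s ∈ maximalIdeal S, O'.valuation (algebraMap S K₁ s) < 1) ∧
        ∃ (d : ℕ) (z : Fin d → S) (a : Fin d → ℕ) (c : Fin d → Sˣ) (g : Fin d → K),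
          Ideal.span (Set.range z) = maximalIdeal S ∧ (∀ j, 0 < a j) ∧
          ∀ j, ι (g j) = algebraMap S K₁ (c j * z j ^ a j)) :
    CossartPiltant2019.{0} :=
  cossartPiltant2019_of_reductionP_headRankOne hloc
    (cossartPiltant2019ReductionP_of_embPrinted_of_equivariantLU_split hloc
      CossartPiltant2019Principalization_holds hCJSE hEqT hEqI)
    hH hhead (cossartJannsenSaito2020_of_embedded hCJSE)

/-- **STUB 2 (all fields) FROM STUB 1 + THE NAMED RESIDUE, with the descent head in `∃`-form at rank one** (hand-1 g17; improves
`cossartPiltant2019_of_stub1_of_leaves_headRankOne`): `CossartPiltant2019.{0}` from `CossartPiltant2019Local`,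
`CossartJannsenSaito2020Embedded.{0}` (= stub 1), `hEqT`, `hEqI`, `Hironaka1964_local` (needed here for the fields of characteristic
zero) and, for every field `k`, the `∃`-form rank-one head for the `B_𝔭` over `k` (allowed to use `CossartPiltant2019LUComplete3`).
[cite: CossartPiltant2019, Thm. 1.1, Thm. 1.5, Props. 4.4, 4.6, 4.8 with Lemma 4.7, 4.10] [cite: CossartJannsenSaito2020, Thm. 1.2, Thm. 1.4]
[cite: Temkin2008, Thm. 2.3.6] [cite: NovacoskiSpivakovsky2014, Thm. 1.1] -/
theorem cossartPiltant2019_of_stub1_of_leaves_headChoiceRankOne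
    (hloc : CossartPiltant2019Local.{0}) (hCJSE : CossartJannsenSaito2020Embedded.{0})
    (hEqT :
      ∀ (p : ℕ), p.Prime →
      ∀ (S : Type) [CommRing S] [IsDomain S] [IsRegularLocalRing S],
        IsExcellentRing S → ringKrullDim S = 3 → CharP (ResidueField S) p →
        IsAdicComplete (maximalIdeal S) S →
      ∀ (E : Type) [Field E] [Algebra S E], Function.Injective (algebraMap S E) →
        IsAlgClosed E → Algebra.IsAlgebraic S E →
      ∀ (OE : ValuationSubring E), (∀ s : S, algebraMap S E s ∈ OE) →
        (∀ s ∈ maximalIdeal S, OE.valuation (algebraMap S E s) < 1) →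
        (∀ y : OE, ∃ q : S[X], (∃ i, q.coeff i ∉ maximalIdeal S) ∧
          OE.valuation (q.eval₂ (algebraMap S E) y) < 1) →
      Nonempty OE.valuation.RankOne →
      ∀ (M' : Subfield E), (∀ s : S, algebraMap S E s ∈ M') →
      ∀ (H : Subgroup (E ≃ₐ[S] E)),
        (∀ σ ∈ H, ∀ x ∈ M', σ x ∈ M') →
        (∀ σ ∈ H, ∀ x ∈ M', x ∈ OE → σ x ∈ OE) →
        (∀ σ ∈ H, ∀ x ∈ M', x ∈ OE → OE.valuation (σ x - x) < 1) →
        (∃ ℓ : ℕ, ℓ.Prime ∧ ℓ ≠ p ∧ ∀ σ ∈ H, ∀ x ∈ M', (σ ^ ℓ) x = x) →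
        (∀ σ ∈ H, (∃ x ∈ M', σ x ≠ x) →
          ∃ x ∈ M', x ≠ 0 ∧ OE.valuation (σ x - x) = OE.valuation x) →
        (∃ t : Finset E, (t : Set E) ⊆ M' ∧
          M' ≤ Subfield.closure (Set.range (algebraMap S E) ∪ (t : Set E)) ∧
          ∃ hTO : (Algebra.adjoin S (t : Set E)).toSubring ≤ OE.toSubring,
            IsRegularLocalRing (Localization.AtPrime
              (Ideal.comap (Subring.inclusion hTO) (maximalIdeal OE)))) →
        ∃ t : Finset E, (t : Set E) ⊆ M' ∧
          M' ≤ Subfield.closure (Set.range (algebraMap S E) ∪ (t : Set E)) ∧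
          ∃ hTO : (Algebra.adjoin S (t : Set E)).toSubring ≤ OE.toSubring,
            IsRegularLocalRing (Localization.AtPrime
              (Ideal.comap (Subring.inclusion hTO) (maximalIdeal OE))) ∧
            (∀ σ ∈ H, ∀ x ∈ locAtCentre (Algebra.adjoin S (t : Set E)).toSubring OE,
              σ x ∈ locAtCentre (Algebra.adjoin S (t : Set E)).toSubring OE))
    (hEqI :
      ∀ (p : ℕ), p.Prime →
      ∀ (S : Type) [CommRing S] [IsDomain S] [IsRegularLocalRing S],
        IsExcellentRing S → ringKrullDim S = 3 → CharP (ResidueField S) p →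
        IsAdicComplete (maximalIdeal S) S →
      ∀ (E : Type) [Field E] [Algebra S E], Function.Injective (algebraMap S E) →
        IsAlgClosed E → Algebra.IsAlgebraic S E →
      ∀ (OE : ValuationSubring E), (∀ s : S, algebraMap S E s ∈ OE) →
        (∀ s ∈ maximalIdeal S, OE.valuation (algebraMap S E s) < 1) →
        (∀ y : OE, ∃ q : S[X], (∃ i, q.coeff i ∉ maximalIdeal S) ∧
          OE.valuation (q.eval₂ (algebraMap S E) y) < 1) →
      Nonempty OE.valuation.RankOne →
      ∀ (M' : Subfield E), (∀ s : S, algebraMap S E s ∈ M') →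
      ∀ (H : Subgroup (E ≃ₐ[S] E)),
        (∀ σ ∈ H, ∀ x ∈ M', σ x ∈ M') →
        (∀ σ ∈ H, ∀ x ∈ M', x ∈ OE → σ x ∈ OE) →
        (∀ σ ∈ H, (∃ x ∈ M', σ x ≠ x) →
          ∃ x ∈ M', OE.valuation x = 1 ∧ OE.valuation (σ x - x) = 1) →
      ∀ (x₀ : E), x₀ ∈ M' → x₀ ∈ OE →
        (∃ t : Finset E, (t : Set E) ⊆ M' ∧
          M' ≤ Subfield.closure (Set.range (algebraMap S E) ∪ (t : Set E)) ∧
          ∃ hTO : (Algebra.adjoin S (t : Set E)).toSubring ≤ OE.toSubring,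
            IsRegularLocalRing (Localization.AtPrime
              (Ideal.comap (Subring.inclusion hTO) (maximalIdeal OE)))) →
        ∃ t : Finset E, (t : Set E) ⊆ M' ∧
          M' ≤ Subfield.closure (Set.range (algebraMap S E) ∪ (t : Set E)) ∧
          ∃ hTO : (Algebra.adjoin S (t : Set E)).toSubring ≤ OE.toSubring,
            IsRegularLocalRing (Localization.AtPrime
              (Ideal.comap (Subring.inclusion hTO) (maximalIdeal OE))) ∧
            (∀ σ ∈ H, ∀ x ∈ locAtCentre (Algebra.adjoin S (t : Set E)).toSubring OE,
              σ x ∈ locAtCentre (Algebra.adjoin S (t : Set E)).toSubring OE) ∧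
            x₀ ∈ locAtCentre (Algebra.adjoin S (t : Set E)).toSubring OE)
    (hH : Hironaka1964_local.{0})
    (hhead : CossartPiltant2019LUComplete3.{0} → ∀ (k : Type) [Field k],
      ∀ (B : Type) [CommRing B] [IsDomain B] [Algebra k B] [Algebra.FiniteType k B]
          (𝔭 : Ideal B) [𝔭.IsMaximal], ringKrullDim B = 3 →
          ringKrullDim (Localization.AtPrime 𝔭) = 3 →
        ∀ (K : Type) [Field K] [Algebra (Localization.AtPrime 𝔭) K]
          [IsFractionRing (Localization.AtPrime 𝔭) K] (O : ValuationSubring K),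
        Nonempty O.valuation.RankOne →
        (∀ x : Localization.AtPrime 𝔭, algebraMap _ K x ∈ O) →
        (∀ x ∈ maximalIdeal (Localization.AtPrime 𝔭), O.valuation (algebraMap _ K x) < 1) →
        (∀ y : O, ∃ q : Polynomial (Localization.AtPrime 𝔭),
          (∃ i, q.coeff i ∉ maximalIdeal (Localization.AtPrime 𝔭)) ∧
          O.valuation (q.eval₂ (algebraMap _ K) y) < 1) →
        ∃ (K₁ : Type) (_ : Field K₁)
          (_ : Algebra (AdicCompletion (maximalIdeal (Localization.AtPrime 𝔭))
            (Localization.AtPrime 𝔭)) K₁),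
          RingHom.ker (algebraMap (AdicCompletion (maximalIdeal (Localization.AtPrime 𝔭))
            (Localization.AtPrime 𝔭)) K₁) ∈
            minimalPrimes (AdicCompletion (maximalIdeal (Localization.AtPrime 𝔭))
              (Localization.AtPrime 𝔭)) ∧
          (∀ z : K₁, ∃ a b : AdicCompletion (maximalIdeal (Localization.AtPrime 𝔭))
            (Localization.AtPrime 𝔭), z = algebraMap _ K₁ a / algebraMap _ K₁ b) ∧
          ∃ (ι : K →+* K₁), ι.comp (algebraMap (Localization.AtPrime 𝔭) K) =
            (algebraMap (AdicCompletion (maximalIdeal (Localization.AtPrime 𝔭))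
              (Localization.AtPrime 𝔭)) K₁).comp (algebraMap (Localization.AtPrime 𝔭) _) ∧
          ∃ (O' : ValuationSubring K₁),
            (∀ y : O', ∃ q : Polynomial (AdicCompletion (maximalIdeal (Localization.AtPrime 𝔭))
              (Localization.AtPrime 𝔭)),
              (∃ i, q.coeff i ∉ (maximalIdeal (Localization.AtPrime 𝔭)).map
                (algebraMap (Localization.AtPrime 𝔭)
                  (AdicCompletion (maximalIdeal (Localization.AtPrime 𝔭)) (Localization.AtPrime 𝔭)))) ∧
              O'.valuation (q.eval₂ (algebraMap _ K₁) y) < 1) ∧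
            O'.comap ι = O ∧
            ∃ (S : Type) (_ : CommRing S) (_ : IsRegularLocalRing S)
              (_ : Algebra (AdicCompletion (maximalIdeal (Localization.AtPrime 𝔭))
                (Localization.AtPrime 𝔭)) S) (_ : Algebra S K₁),
              IsLocalHom (algebraMap (AdicCompletion (maximalIdeal (Localization.AtPrime 𝔭))
                (Localization.AtPrime 𝔭)) S) ∧
              Algebra.EssFiniteType (AdicCompletion (maximalIdeal (Localization.AtPrime 𝔭))
                (Localization.AtPrime 𝔭)) S ∧
              IsScalarTower (AdicCompletion (maximalIdeal (Localization.AtPrime 𝔭))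
                (Localization.AtPrime 𝔭)) S K₁ ∧
              Function.Injective (algebraMap S K₁) ∧
              (∀ s : S, algebraMap S K₁ s ∈ O') ∧
              (∀ s ∈ maximalIdeal S, O'.valuation (algebraMap S K₁ s) < 1) ∧
              ∃ (d : ℕ) (z : Fin d → S) (a : Fin d → ℕ) (c : Fin d → Sˣ) (g : Fin d → K),
                Ideal.span (Set.range z) = maximalIdeal S ∧ (∀ j, 0 < a j) ∧
                ∀ j, ι (g j) = algebraMap S K₁ (c j * z j ^ a j)) :
    CossartPiltant2019.{0} :=
  cossartPiltant2019_of_local hloc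
    (cossartPiltant2019ReductionP_of_embPrinted_of_equivariantLU_split hloc
      CossartPiltant2019Principalization_holds hCJSE hEqT hEqI)
    (CossartPiltant2019LUCompleteChar0_holds_of hH)
    (CossartPiltant2019LU3OfComplete.of_headChoiceRankOne (cossartJannsenSaito2020_of_embedded hCJSE) hhead)
    (cossartJannsenSaito2020_of_embedded hCJSE) CossartPiltant2019Patching_holds

end Summit.ResolutionOfSingularities.ResolutionOfSingularities.Theorems.RadicialJung.CleanModels

end
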